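import Mathlib.RingTheory.LocalProperties.Basic
import Mathlib.RingTheory.IntegralClosure.IntegrallyClosed
import Mathlib.RingTheory.Localization.AtPrime.Basic
import Mathlib.RingTheory.Localization.FractionRing
import Mathlib.RingTheory.Localization.Basic
import HarnessLib

/-!
# Integral closedness in the total ring of fractions is implied by its local versions

Topic: `Literature/RingTheory/IntegralClosure`. Mathlib's `IsIntegrallyClosed.of_localization_maximal`
("an integral domain `R` is integrally closed if `Rₘ` is integrally closed for every maximal ideal
`m`", The Stacks Project, Tag 030B / Matsumura, *Commutative Ring Theory*, remark after Thm 9.?;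
Atiyah–Macdonald Prop. 5.13) is stated for DOMAINS. The same argument works for an arbitrary
commutative ring `R` and Mathlib's general notion `IsIntegrallyClosed R` (= integrally closed in
the total ring of fractions `FractionRing R = R[(R⁰)⁻¹]`):

* `isIntegrallyClosed_of_localization_maximal` — if `R_𝔪` is integrally closed in ITS total
  ring of fractions for every maximal ideal `𝔪`, then `R` is integrally closed in its total ring
  of fractions.

Proof: a non-zero-divisor of `R` stays a non-zero-divisor in `R_𝔪` (Mathlib
`IsLocalization.nonZeroDivisors_le_comap`), so `Frac R → Frac R_𝔪` is defined; if `x = a/s` is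
integral over `R`, its image is integral over `R_𝔪`, hence `a ∈ s R_𝔪` for every `𝔪`, hence
`a ∈ sR` (ideal membership is local, `Ideal.mem_of_localization_maximal`), i.e. `x ∈ R`.
(The converse, "integrally closed localises", needs hypotheses for non-domains and is not here.)

Used for the normality of schemes with finite diagonalizable quotient singularities
(`Literature/AlgebraicGeometry/Resolution/TameQuotientSingularitiesResolutionProofs.lean`), whose
chart rings are smooth but possibly disconnected. Only Mathlib is used.
[cite: StacksProject, Tag 030B]
-/

noncomputable section

namespace Literature.RingTheory.IntegralClosure

universe u

/-- **Integral closedness (in the total ring of fractions) can be checked at the maximal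
ideals**, for an arbitrary commutative ring: if every `R_𝔪` is integrally closed in its total
ring of fractions then so is `R`. [cite: StacksProject, Tag 030B] -/
theorem isIntegrallyClosed_of_localization_maximal {R : Type u} [CommRing R]
    (h : ∀ (p : Ideal R) [p.IsMaximal], IsIntegrallyClosed (Localization.AtPrime p)) :
    IsIntegrallyClosed R := by
  rw [isIntegrallyClosed_iff (FractionRing R)]
  intro x hx
  obtain ⟨⟨a, s⟩, rfl⟩ := IsLocalization.mk'_surjective (nonZeroDivisors R) x
  -- it suffices that `a ∈ sR`
  suffices ha : a ∈ Ideal.span {(s : R)} by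
    obtain ⟨a', ha'⟩ := Ideal.mem_span_singleton'.mp ha
    exact ⟨a', by rw [IsLocalization.eq_mk'_iff_mul_eq, ← map_mul, ha']⟩
  refine Ideal.mem_of_localization_maximal fun p hp => ?_
  haveI := h p
  let Rp := Localization.AtPrime p
  let K := FractionRing Rp
  -- non-zero-divisors of `R` become units in `Frac R_p`
  have hu : ∀ t : nonZeroDivisors R, IsUnit (Algebra.ofId R K t) := fun t => by
    rw [Algebra.ofId_apply, IsScalarTower.algebraMap_apply R Rp K]
    exact IsLocalization.map_units K
      (⟨algebraMap R Rp t, IsLocalization.nonZeroDivisors_le_comap p.primeCompl Rp t.2⟩ :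
        nonZeroDivisors Rp)
  let f : FractionRing R →ₐ[R] K :=
    IsLocalization.liftAlgHom (M := nonZeroDivisors R) (f := Algebra.ofId R K) hu
  obtain ⟨c, hc⟩ := (IsIntegrallyClosed.isIntegral_iff (R := Rp) (K := K)).mp (hx.map f).tower_top
  -- `c * s = a` in `R_p`
  have hcs : c * algebraMap R Rp s = algebraMap R Rp a := by
    apply IsFractionRing.injective Rp K
    have h2 := congrArg f (IsLocalization.mk'_spec (FractionRing R) a s)
    rw [map_mul, AlgHom.commutes, AlgHom.commutes, ← hc,
      IsScalarTower.algebraMap_apply R Rp K (s : R), IsScalarTower.algebraMap_apply R Rp K a,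
      ← map_mul] at h2
    exact h2
  rw [Ideal.map_span, Set.image_singleton]
  exact Ideal.mem_span_singleton'.mpr ⟨c, hcs⟩

end Literature.RingTheory.IntegralClosure

end
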